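import Summits.AtomisticToContinuum.Crystallization.Theorems.FrustratedLawDichotomyStrainedPatchHomLeafTableDataHcpU
import Summits.AtomisticToContinuum.Crystallization.Theorems.FrustratedLawDichotomyStrainedPatchHomLeafTableHcp
import Summits.AtomisticToContinuum.Crystallization.Theorems.FrustratedLawDichotomyStrainedPatchHomLeafTableDataCert

/-!
# hcp table leaf checker — CERTIFICATION of the literal label list (kernel `decide`) and ★★ the assembled hcp Gram-leaf certificate

decomp-a2c hand-2 g24 (crux `AperiodicFrustratedLawGap`, stmt-AtomisticToContinuum-27623; β2-hcp, critic rows 864/865).  The 1404 records of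
`nearLabelsH` are consistent (`allOKH`), strictly key-sorted (`chainLtH`, hence `(fam, label)`-nodup), boxed (`allInBoxH`), COVER both families of
`[−7,7]³` below the far thresholds (`coverH`), and have class sums `tabHA0 … tabHA9`; the `q`-table is hand-1's `qTable` with its certificate
`qTable_allOK` REUSED.  ★★ `boxSumH_ge_of_leafCheckH`: one kernel evaluation `leafCheckH qTable nearLabelsH tabE tabHA0 … tabHA9 k sμ aμ = true` ⟹ the hcp
two-family `W₄₅` label sum is `≥ ±aμ/(2·SC)` for every `‖U − 1‖ ≤ 1/4`, `|ξᵢ| ≤ 1/4` with class point in the class box `k`.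
`--supports stmt-AtomisticToContinuum-27623`.
-/

noncomputable section

namespace Summit.AtomisticToContinuum.Crystallization.Theorems.FrustratedLawDichotomyStrainedPatchHomLeafTableCheckHcp

open scoped BigOperators RealInnerProductSpace
open Literature.Analysis.ValidatedNumerics.Numerics
open Summit.AtomisticToContinuum.Crystallization.Theorems.ChargedEnergyGapNegative (E3)
open Summit.AtomisticToContinuum.Crystallization.Theorems.FrustratedLawDichotomySchurCut (effPot w₄₅ ω₄)
open Summit.AtomisticToContinuum.Crystallization.Theorems.FrustratedLawDichotomyStrainedPatchHomSplit (latPt hexFrame hcpShift)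
open Summit.AtomisticToContinuum.Crystallization.Theorems.FrustratedLawDichotomyStrainedPatchHomLeafTableCheck
  (Row QT sgnZ SCN qTable tabE qTable_allOK)

/-- The records are consistent with their `(fam, label)`. [kernel computation] -/
theorem nearLabelsH_ok : allOKH nearLabelsH = true := by decide +kernel

/-- The records are strictly key-sorted. [kernel computation] -/
theorem nearLabelsH_chain : chainLtH nearLabelsH = true := by decide +kernel

/-- The records are boxed (labels in `[−7,7]³`, unshifted labels non-zero). [kernel computation] -/
theorem nearLabelsH_inBox : allInBoxH nearLabelsH = true := by decide +kernel

/-- ★ The list COVERS both families of `[−7,7]³` below the far thresholds `324` / `378`. [kernel computation] -/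
theorem nearLabelsH_cover : coverH nearLabelsH = true := by decide +kernel

/-- The ten class sums. [kernel computation] -/
theorem nearLabelsH_sums : ∀ j : Fin 10, sumMag nearLabelsH j ≤ vec10 tabHA0 tabHA1 tabHA2 tabHA3 tabHA4 tabHA5 tabHA6 tabHA7 tabHA8 tabHA9 j := by
  decide +kernel

/-- ★★ **THE hcp GRAM-LEAF CERTIFICATE, assembled, ANY semantically certified table** (v2 `qTable`, or hand-1's v3 "K" table via `tabSem_of_allOKK`):
a single kernel/native evaluation `leafCheckH tab nearLabelsH E tabHA0 … tabHA9 k sμ aμ = true` bounds the hcp two-family label sum from below on the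
whole class box `k`. [folklore] -/
theorem boxSumH_ge_of_leafCheckH_sem {tab : QT} {E : ℕ} (htab : TabSem E tab) {k : LH} {sμ : Bool} {aμ : ℕ}
    (h : leafCheckH tab nearLabelsH E tabHA0 tabHA1 tabHA2 tabHA3 tabHA4 tabHA5 tabHA6 tabHA7 tabHA8 tabHA9 k sμ aμ = true)
    (U : E3 →L[ℝ] E3) (hU : ‖U - 1‖ ≤ 1 / 4) (ξ : E3) (hξ : ∀ i : Fin 3, |ξ i| ≤ 1 / 4)
    (hbox : ∀ j, |xH U hexFrame (hcpShift + ξ) j - ((k.cZ j : ℤ) : ℝ) / SC| ≤ ((k.wN j : ℕ) : ℝ) / SC) :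
    ((sgnZ sμ aμ : ℤ) : ℝ) / SC / 2 ≤
      ∑ b ∈ (Fintype.piFinset fun _ : Fin 3 => Finset.Icc (-7 : ℤ) 7).filter (fun b => b ≠ 0), effPot w₄₅ ω₄ (3 / 400) ‖latPt U hexFrame b‖ +
        ∑ b ∈ (Fintype.piFinset fun _ : Fin 3 => Finset.Icc (-7 : ℤ) 7), effPot w₄₅ ω₄ (3 / 400) ‖latPt U hexFrame b + U (hcpShift + ξ)‖ :=
  leafCheckH_sound_hcp htab nearLabelsH_ok (keyNodup_of_chainLtH nearLabelsH_chain) nearLabelsH_inBox nearLabelsH_cover nearLabelsH_sums h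
    U hU ξ hξ hbox

/-- ★★ **THE hcp GRAM-LEAF CERTIFICATE with hand-1's v2 table `qTable`** (certificate `qTable_allOK` reused). [folklore] -/
theorem boxSumH_ge_of_leafCheckH {k : LH} {sμ : Bool} {aμ : ℕ}
    (h : leafCheckH qTable nearLabelsH tabE tabHA0 tabHA1 tabHA2 tabHA3 tabHA4 tabHA5 tabHA6 tabHA7 tabHA8 tabHA9 k sμ aμ = true)
    (U : E3 →L[ℝ] E3) (hU : ‖U - 1‖ ≤ 1 / 4) (ξ : E3) (hξ : ∀ i : Fin 3, |ξ i| ≤ 1 / 4)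
    (hbox : ∀ j, |xH U hexFrame (hcpShift + ξ) j - ((k.cZ j : ℤ) : ℝ) / SC| ≤ ((k.wN j : ℕ) : ℝ) / SC) :
    ((sgnZ sμ aμ : ℤ) : ℝ) / SC / 2 ≤
      ∑ b ∈ (Fintype.piFinset fun _ : Fin 3 => Finset.Icc (-7 : ℤ) 7).filter (fun b => b ≠ 0), effPot w₄₅ ω₄ (3 / 400) ‖latPt U hexFrame b‖ +
        ∑ b ∈ (Fintype.piFinset fun _ : Fin 3 => Finset.Icc (-7 : ℤ) 7), effPot w₄₅ ω₄ (3 / 400) ‖latPt U hexFrame b + U (hcpShift + ξ)‖ :=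
  boxSumH_ge_of_leafCheckH_sem (tabSem_of_allOK qTable_allOK) h U hU ξ hξ hbox

end Summit.AtomisticToContinuum.Crystallization.Theorems.FrustratedLawDichotomyStrainedPatchHomLeafTableCheckHcp

end
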